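import Literature.MathematicalPhysics.QuantumFieldTheory.ConformalBootstrap3D.SigmaEpsilonSystem
import Mathlib.Tactic
import HarnessLib

/-!
# Kernel form of the recognition cell's exclusion sentences (cell `pub-ising3x`, seat recog-1)

HONEST FRAMING: lottery ticket; floor = tightest certified 3D Ising CFT bounds; no exact-solution
claim without a proof.

The recognition plan of the cell (`run/shared/lean/pub/pub-ising3x/SCOPE.md` §3; frozen family list
`HOME/frozen/FAMILIES-v1.json`, sha256 `b39f709f54e6a505…`) runs a deterministic exact recogniser over
closed-form families inside every CERTIFIED interval and reports, first of all, an EXCLUSION LIST: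
"no rational of denominator `≤ Q`, no Virasoro Kac-table value with `p′ ≤ 24`, `n ≤ 8`, none of the
closed forms proposed in print … lies in the certified interval, except the listed members".
Those sentences are produced by a Python program (`HOME/code/recog/`, two implementations). This file
is their KERNEL form — the second, independent verification the cell's rules ask for
("every hit/certificate independently VERIFIED … Lean `decide`/kernel where feasible"):

* `ratExcluded Q a b ex` (a `Bool`, evaluated by `decide +kernel`) and `ratExcluded_sound`: if it
  returns `true` then every rational `r` with `r.den ≤ Q` and `a ≤ r ≤ b` belongs to the list `ex`.
* `kacValue p p' r s n = 2 h_{r,s}(p,p′) + n` with the Kac weight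
  `h_{r,s} = ((p′ r − p s)² − (p′ − p)²) / (4 p p′)` of the Virasoro minimal model `M(p,p′)`
  (Belavin–Polyakov–Zamolodchikov 1984; Di Francesco–Mathieu–Sénéchal 1997, eq. (7.65)), the
  membership set `kacFamily N nmax` (exactly the frozen family `KAC`: `2 ≤ p < p′ ≤ N`
  coprime, `1 ≤ r ≤ p − 1`, `1 ≤ s ≤ p′ − 1`, spinless descendant level `n ≤ nmax`; the cell uses
  `N = 24`, `nmax = 8`), the checker `kacExcluded N nmax a b ex` and `kacExcluded_sound`.
* `namedSigma`, `namedEps`, `namedPairs` — the in-print closed-form proposals for `(Δ_σ, Δ_ε)` of the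
  3D Ising CFT (families `NAMED`/`NAMEDJ` of FAMILIES-v1 plus the quarantined late supplements), as data.
* Bridges from the floor's statements (`IsingEnclosure W R`, `BoxExcluded Q` of
  `Literature/…/ConformalBootstrap3D/SigmaEpsilonSystem.lean`, the typed axioms A0–A5) to sentences
  about `Δ_σ`, `Δ_ε`: `sigma_ne_rat_of_isingEnclosure`, `eps_ne_rat_of_isingEnclosure`,
  `sigma_not_kac_of_isingEnclosure`, `eps_not_kac_of_isingEnclosure`, `point_not_attained_of_isingEnclosure`,
  `point_not_attained_of_boxExcluded`; and the one catalogue entry the typed unitarity axiom A1 refutes by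
  itself, `deltaSigma_ne_fifteen_div_thirtyOne` (`Δ_σ = 15/31`, Thompson's series-era set B).
* Kernel-checked EXAMPLES live in `ExclusionSentencesControl2D.lean` (2D control values only:
  no certified 3D interval exists in phase 0 and none is used anywhere).

Design: the checkers loop over integers only (the Kac checker solves for the level `n` by Euclidean
division instead of looping over it), so that one `decide +kernel` evaluates a full `p′ ≤ 24` sentence
in seconds; `Bool`-valued checkers + soundness theorems, no `native_decide`, no new axioms.
What is NOT here: any certificate, any 3D digit, any claim about the 3D Ising model; the false-match
statistics of SCOPE §3.4 (acceptance is a statistical protocol, not a theorem); the other frozen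
families (ALG/LIN/TRG need certified real-algebraic / transcendental-constant enclosures — exactrec's
job, reported, never kernel-checked here).
-/

namespace Summit.CriticalPhenomena.Ising3D

open Literature.MathematicalPhysics.QuantumFieldTheory.ConformalBootstrap3D

/-! ### A bounded integer quantifier -/

/-- `allIntIcc lo hi f`: `f` holds at every integer of the closed range `[lo, hi]` (vacuously `true`
when `hi < lo`). Computable; used by the checkers below. -/
def allIntIcc (lo hi : ℤ) (f : ℤ → Bool) : Bool :=
  (List.range (hi + 1 - lo).toNat).all fun i => f (lo + (i : ℤ))

/-- Soundness of `allIntIcc`: if it returns `true` then `f n = true` for every `lo ≤ n ≤ hi`. -/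
theorem allIntIcc_sound {lo hi : ℤ} {f : ℤ → Bool} (h : allIntIcc lo hi f = true) {n : ℤ}
    (hlo : lo ≤ n) (hhi : n ≤ hi) : f n = true := by
  unfold allIntIcc at h
  rw [List.all_eq_true] at h
  have hmem : (n - lo).toNat ∈ List.range (hi + 1 - lo).toNat := by
    rw [List.mem_range]; omega
  have e : lo + (((n - lo).toNat : ℕ) : ℤ) = n := by omega
  have h' := h _ hmem
  rwa [e] at h'

/-! ### Two casting lemmas: a rational against an integer fraction `X / D` -/

/-- For `D > 0`: `a ≤ X / D` in `ℚ` iff `a.num · D ≤ X · a.den` in `ℤ`. -/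
theorem le_intDiv_iff (a : ℚ) (X : ℤ) {D : ℕ} (hD : 0 < D) :
    a ≤ (X : ℚ) / (D : ℚ) ↔ a.num * (D : ℤ) ≤ X * (a.den : ℤ) := by
  have hD' : (0 : ℚ) < D := by exact_mod_cast hD
  have hden : (0 : ℚ) < a.den := by exact_mod_cast a.den_pos
  rw [le_div_iff₀ hD']
  constructor
  · intro h
    have h2 : (a.num : ℚ) * D ≤ X * a.den := by
      calc (a.num : ℚ) * D = a * D * a.den := by rw [mul_right_comm, Rat.mul_den_eq_num]
        _ ≤ X * a.den := mul_le_mul_of_nonneg_right h hden.le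
    exact_mod_cast h2
  · intro h
    have h2 : (a.num : ℚ) * D ≤ X * a.den := by exact_mod_cast h
    have h3 : a * D * a.den ≤ X * a.den := by
      calc a * D * a.den = a.num * D := by rw [mul_right_comm, Rat.mul_den_eq_num]
        _ ≤ X * a.den := h2
    exact le_of_mul_le_mul_right h3 hden

/-- For `D > 0`: `X / D ≤ b` in `ℚ` iff `X · b.den ≤ b.num · D` in `ℤ`. -/
theorem intDiv_le_iff (b : ℚ) (X : ℤ) {D : ℕ} (hD : 0 < D) :
    (X : ℚ) / (D : ℚ) ≤ b ↔ X * (b.den : ℤ) ≤ b.num * (D : ℤ) := by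
  have hD' : (0 : ℚ) < D := by exact_mod_cast hD
  have hden : (0 : ℚ) < b.den := by exact_mod_cast b.den_pos
  rw [div_le_iff₀ hD']
  constructor
  · intro h
    have h2 : (X : ℚ) * b.den ≤ b.num * D := by
      calc (X : ℚ) * b.den ≤ b * D * b.den := mul_le_mul_of_nonneg_right h hden.le
        _ = b.num * D := by rw [mul_right_comm, Rat.mul_den_eq_num]
    exact_mod_cast h2
  · intro h
    have h2 : (X : ℚ) * b.den ≤ b.num * D := by exact_mod_cast h
    have h3 : (X : ℚ) * b.den ≤ b * D * b.den := by rwa [mul_right_comm, Rat.mul_den_eq_num]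
    exact le_of_mul_le_mul_right h3 hden

/-- For `D > 0`: if `X · q.den = q.num · D` in `ℤ` then `X / D = q` in `ℚ`. -/
theorem intDiv_eq_of_cross (q : ℚ) (X : ℤ) {D : ℕ} (hD : 0 < D)
    (h : X * (q.den : ℤ) = q.num * (D : ℤ)) : (X : ℚ) / (D : ℚ) = q := by
  have hD' : (D : ℚ) ≠ 0 := by positivity
  have hden : (q.den : ℚ) ≠ 0 := by positivity
  have e : (X : ℚ) / D = (q.num : ℚ) / q.den := by
    rw [div_eq_div_iff hD' hden]; exact_mod_cast h
  rw [e, Rat.num_div_den]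

/-! ### Family RAT: rationals of bounded denominator -/

/-- `ratExcluded Q a b ex = true` certifies: every rational `p/q` with `1 ≤ q ≤ Q` and
`a ≤ p/q ≤ b` (searched as `⌈a q⌉ ≤ p ≤ ⌊b q⌋`) is, as a rational number, a member of the
exception list `ex` (membership tested by cross-multiplication against the reduced form). This is
the recogniser's family `RAT` exclusion sentence "no rational with denominator `≤ Q` in the certified
interval except …" (SCOPE §3.1, §3.5). -/
def ratExcluded (Q : ℕ) (a b : ℚ) (ex : List ℚ) : Bool :=
  (List.range' 1 Q).all fun q =>
    allIntIcc ⌈a * (q : ℚ)⌉ ⌊b * (q : ℚ)⌋ fun p =>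
      ex.any fun e => decide (p * (e.den : ℤ) = e.num * (q : ℤ))

/-- **Soundness of the RAT sentence.** If `ratExcluded Q a b ex = true`, every rational `r` with
denominator `≤ Q` in `[a, b]` belongs to `ex`. -/
theorem ratExcluded_sound {Q : ℕ} {a b : ℚ} {ex : List ℚ} (h : ratExcluded Q a b ex = true)
    {r : ℚ} (hden : r.den ≤ Q) (ha : a ≤ r) (hb : r ≤ b) : r ∈ ex := by
  unfold ratExcluded at h
  rw [List.all_eq_true] at h
  have hq : r.den ∈ List.range' 1 Q := by
    rw [List.mem_range'_1]; have := r.den_pos; omega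
  have h1 := h _ hq
  have hdq : (0 : ℚ) ≤ (r.den : ℚ) := by positivity
  have hlo : ⌈a * (r.den : ℚ)⌉ ≤ r.num := by
    rw [Int.ceil_le]
    calc a * (r.den : ℚ) ≤ r * r.den := mul_le_mul_of_nonneg_right ha hdq
      _ = r.num := Rat.mul_den_eq_num r
  have hhi : r.num ≤ ⌊b * (r.den : ℚ)⌋ := by
    rw [Int.le_floor]
    calc (r.num : ℚ) = r * r.den := (Rat.mul_den_eq_num r).symm
      _ ≤ b * r.den := mul_le_mul_of_nonneg_right hb hdq
  have h2 := allIntIcc_sound h1 hlo hhi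
  obtain ⟨e, he, hdec⟩ := List.any_eq_true.mp h2
  rw [decide_eq_true_eq] at hdec
  have : r = e := by rw [Rat.eq_iff_mul_eq_mul]; exact hdec
  exact this ▸ he

/-- Real-number form: a real `x ∈ [a, b]` equal to a rational of denominator `≤ Q` outside `ex`
contradicts `ratExcluded Q a b ex = true`. -/
theorem ne_rat_of_ratExcluded {Q : ℕ} {a b : ℚ} {ex : List ℚ} (h : ratExcluded Q a b ex = true)
    {x : ℝ} (hx : (a : ℝ) ≤ x ∧ x ≤ b) (r : ℚ) (hden : r.den ≤ Q) (hr : r ∉ ex) : x ≠ (r : ℝ) := by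
  rintro rfl
  exact hr (ratExcluded_sound h hden (by exact_mod_cast hx.1) (by exact_mod_cast hx.2))

/-! ### Family KAC: Virasoro minimal-model values `2 h_{r,s}(p,p′) + n` -/

/-- The numerator `(p′ r − p s)² − (p′ − p)²` of `4 p p′ · h_{r,s}(p,p′)` (an integer, possibly
negative for non-unitary `M(p,p′)`). -/
def kacNum (p p' r s : ℕ) : ℤ :=
  (((p' * r : ℕ) : ℤ) - ((p * s : ℕ) : ℤ)) ^ 2 - (((p' : ℤ) - (p : ℤ)) ^ 2)

/-- `kacValue p p' r s n = 2 h_{r,s}(p,p′) + n`, the scaling dimension `Δ = h + h̄` of the spinless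
level-`n` descendant of the primary `φ_{r,s}` of the Virasoro minimal model `M(p,p′)`, with the Kac
weight `h_{r,s}(p,p′) = ((p′ r − p s)² − (p′ − p)²)/(4 p p′)` (Belavin–Polyakov–Zamolodchikov 1984;
Di Francesco–Mathieu–Sénéchal, *Conformal Field Theory* (1997), eq. (7.65) and (8.4), p. 210/232 —
printed there with the roles of `p, p′` exchanged, `1 ≤ r ≤ p′ − 1`, `1 ≤ s ≤ p − 1`, the same value
set; this file follows the cell's `families.py`: `r < p`, `s < p′`); written as one integer fraction
over `2 p p′` (see `kacValue_eq`). -/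
def kacValue (p p' r s n : ℕ) : ℚ :=
  ((kacNum p p' r s + ((2 * p * p' : ℕ) : ℤ) * ((n : ℕ) : ℤ) : ℤ) : ℚ) / (((2 * p * p' : ℕ) : ℤ) : ℚ)

/-- `kacValue` is the textbook formula `2 · ((p′ r − p s)² − (p′ − p)²)/(4 p p′) + n`. -/
theorem kacValue_eq {p p' : ℕ} (hp : 0 < p) (hp' : 0 < p') (r s n : ℕ) :
    kacValue p p' r s n =
      2 * ((((p' : ℚ) * r - p * s) ^ 2 - ((p' : ℚ) - p) ^ 2) / (4 * p * p')) + n := by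
  unfold kacValue kacNum
  have hp0 : (p : ℚ) ≠ 0 := by positivity
  have hp0' : (p' : ℚ) ≠ 0 := by positivity
  push_cast
  field_simp
  ring

/-- `kacFamily N nmax`: the frozen family `KAC` of FAMILIES-v1 as a set of rationals — all
`2 h_{r,s}(p,p′) + n` with coprime `2 ≤ p < p′ ≤ N`, `1 ≤ r ≤ p − 1`, `1 ≤ s ≤ p′ − 1`, `0 ≤ n ≤ nmax`
(the cell's table: `N = 24`, `nmax = 8`, 69 545 values; non-unitary models included, exactly as
`HOME/code/recog/families.py kac_virasoro`). -/
def kacFamily (N nmax : ℕ) : Set ℚ :=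
  {v | ∃ p p' r s n : ℕ, 2 ≤ p ∧ p < p' ∧ p' ≤ N ∧ Nat.Coprime p p' ∧ 1 ≤ r ∧ r < p ∧ 1 ≤ s ∧
    s < p' ∧ n ≤ nmax ∧ v = kacValue p p' r s n}

/-- The 2D Ising value `Δ_σ = 1/8 = 2 h_{1,2}(M(3,4))` is a Kac member (sanity check of the
conventions; `r` ranges with `p = 3`, `s` with `p′ = 4`). -/
theorem one_eighth_mem_kacFamily : (1 / 8 : ℚ) ∈ kacFamily 24 8 := by
  simp only [kacFamily, Set.mem_setOf_eq]
  exact ⟨3, 4, 1, 2, 0, by norm_num, by norm_num, by norm_num, by norm_num, by norm_num, by norm_num,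
    by norm_num, by norm_num, by norm_num, by norm_num [kacValue, kacNum]⟩

/-- The 2D Ising value `Δ_ε = 1 = 2 h_{2,1}(M(3,4))` is a Kac member. -/
theorem one_mem_kacFamily : (1 : ℚ) ∈ kacFamily 24 8 := by
  simp only [kacFamily, Set.mem_setOf_eq]
  exact ⟨3, 4, 2, 1, 0, by norm_num, by norm_num, by norm_num, by norm_num, by norm_num, by norm_num,
    by norm_num, by norm_num, by norm_num, by norm_num [kacValue, kacNum]⟩

/-- Smallest level `n` compatible with `a ≤ 2h + n`: `⌈(a.num·D − X₀·a.den)/(D·a.den)⌉` with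
`D = 2 p p′`, `X₀ = kacNum`, computed by Euclidean division (`-((-u)/c)`). -/
def kacNLo (an : ℤ) (ad : ℕ) (p p' r s : ℕ) : ℤ :=
  -((-(an * ((2 * p * p' : ℕ) : ℤ) - kacNum p p' r s * (ad : ℤ))) / ((2 * p * p' * ad : ℕ) : ℤ))

/-- Largest level `n` compatible with `2h + n ≤ b`: `⌊(b.num·D − X₀·b.den)/(D·b.den)⌋`. -/
def kacNHi (bn : ℤ) (bd : ℕ) (p p' r s : ℕ) : ℤ :=
  (bn * ((2 * p * p' : ℕ) : ℤ) - kacNum p p' r s * (bd : ℤ)) / ((2 * p * p' * bd : ℕ) : ℤ)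

/-- `kacNLo` is a lower bound for every admissible level. -/
theorem kacNLo_le {an : ℤ} {ad : ℕ} (had : 0 < ad) {p p' r s : ℕ} (hD : 0 < 2 * p * p') {n : ℤ}
    (h : an * ((2 * p * p' : ℕ) : ℤ) ≤ (kacNum p p' r s + ((2 * p * p' : ℕ) : ℤ) * n) * (ad : ℤ)) :
    kacNLo an ad p p' r s ≤ n := by
  unfold kacNLo
  have hc : (0 : ℤ) < ((2 * p * p' * ad : ℕ) : ℤ) := by exact_mod_cast Nat.mul_pos hD had
  rw [neg_le, Int.le_ediv_iff_mul_le hc]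
  push_cast at h hc ⊢
  nlinarith [h]

/-- `kacNHi` is an upper bound for every admissible level. -/
theorem le_kacNHi {bn : ℤ} {bd : ℕ} (hbd : 0 < bd) {p p' r s : ℕ} (hD : 0 < 2 * p * p') {n : ℤ}
    (h : (kacNum p p' r s + ((2 * p * p' : ℕ) : ℤ) * n) * (bd : ℤ) ≤ bn * ((2 * p * p' : ℕ) : ℤ)) :
    n ≤ kacNHi bn bd p p' r s := by
  unfold kacNHi
  have hc : (0 : ℤ) < ((2 * p * p' * bd : ℕ) : ℤ) := by exact_mod_cast Nat.mul_pos hD hbd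
  rw [Int.le_ediv_iff_mul_le hc]
  push_cast at h hc ⊢
  nlinarith [h]

/-- Integer core of the KAC checker: interval `[an/ad, bn/bd]`, exceptions as `(num, den)` pairs.
Loops over `p′ ∈ [3, N]`, `p ∈ [2, p′ − 1]` coprime to `p′`, `r ∈ [1, p − 1]`, `s ∈ [1, p′ − 1]`, and
over the levels `n ∈ [max 0 nlo, min nmax nhi]` only. -/
def kacCore (N nmax : ℕ) (an : ℤ) (ad : ℕ) (bn : ℤ) (bd : ℕ) (ex : List (ℤ × ℕ)) : Bool :=
  (List.range' 3 (N - 2)).all fun p' =>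
    (List.range' 2 (p' - 2)).all fun p =>
      if Nat.Coprime p p' then
        (List.range' 1 (p - 1)).all fun r =>
          (List.range' 1 (p' - 1)).all fun s =>
            allIntIcc (max 0 (kacNLo an ad p p' r s)) (min (nmax : ℤ) (kacNHi bn bd p p' r s))
              fun n => ex.any fun e =>
                decide ((kacNum p p' r s + ((2 * p * p' : ℕ) : ℤ) * n) * (e.2 : ℤ) =
                  e.1 * ((2 * p * p' : ℕ) : ℤ))
      else true

/-- `kacExcluded N nmax a b ex = true` certifies: every member of the family `KAC(N, nmax)` lying in
`[a, b]` belongs to the exception list `ex` — the recogniser's sentence "no Kac-table value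
(`p′ ≤ N`, level `≤ nmax`) in the certified interval except …" (SCOPE §3.1, §3.5). -/
def kacExcluded (N nmax : ℕ) (a b : ℚ) (ex : List ℚ) : Bool :=
  kacCore N nmax a.num a.den b.num b.den (ex.map fun e => (e.num, e.den))

/-- **Soundness of the KAC sentence.** If `kacExcluded N nmax a b ex = true` then every
`v ∈ kacFamily N nmax` with `a ≤ v ≤ b` belongs to `ex`. -/
theorem kacExcluded_sound {N nmax : ℕ} {a b : ℚ} {ex : List ℚ}
    (h : kacExcluded N nmax a b ex = true) {v : ℚ} (hv : v ∈ kacFamily N nmax) (ha : a ≤ v)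
    (hb : v ≤ b) : v ∈ ex := by
  simp only [kacFamily, Set.mem_setOf_eq] at hv
  obtain ⟨p, p', r, s, n, hp, hpp, hN, hcop, hr1, hr, hs1, hs, hn, rfl⟩ := hv
  have hD : 0 < 2 * p * p' := Nat.mul_pos (Nat.mul_pos (by norm_num) (by omega)) (by omega)
  unfold kacExcluded kacCore at h
  have h1 := List.all_eq_true.mp h p' (List.mem_range'_1.mpr ⟨by omega, by omega⟩)
  have h2 := List.all_eq_true.mp h1 p (List.mem_range'_1.mpr ⟨hp, by omega⟩)
  rw [if_pos hcop] at h2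
  have h3 := List.all_eq_true.mp h2 r (List.mem_range'_1.mpr ⟨hr1, by omega⟩)
  have h4 := List.all_eq_true.mp h3 s (List.mem_range'_1.mpr ⟨hs1, by omega⟩)
  have ha' := (le_intDiv_iff a _ hD).mp ha
  have hb' := (intDiv_le_iff b _ hD).mp hb
  have hlo : max 0 (kacNLo a.num a.den p p' r s) ≤ (n : ℤ) :=
    max_le (Int.natCast_nonneg n) (kacNLo_le a.den_pos hD ha')
  have hhi : (n : ℤ) ≤ min (nmax : ℤ) (kacNHi b.num b.den p p' r s) :=
    le_min (by exact_mod_cast hn) (le_kacNHi b.den_pos hD hb')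
  have h5 := allIntIcc_sound h4 hlo hhi
  obtain ⟨e, he, hdec⟩ := List.any_eq_true.mp h5
  rw [decide_eq_true_eq] at hdec
  rw [List.mem_map] at he
  obtain ⟨q, hq, rfl⟩ := he
  have : kacValue p p' r s n = q := intDiv_eq_of_cross q _ hD hdec
  exact this ▸ hq

/-- Real-number form of the KAC sentence. -/
theorem ne_kac_of_kacExcluded {N nmax : ℕ} {a b : ℚ} {ex : List ℚ}
    (h : kacExcluded N nmax a b ex = true) {x : ℝ} (hx : (a : ℝ) ≤ x ∧ x ≤ b) (v : ℚ)
    (hv : v ∈ kacFamily N nmax) (hvex : v ∉ ex) : x ≠ (v : ℝ) := by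
  rintro rfl
  exact hvex (kacExcluded_sound h hv (by exact_mod_cast hx.1) (by exact_mod_cast hx.2))

/-! ### Family NAMED: the closed forms proposed in print (data) -/

/-- `Δ_σ`-projections of the closed-form proposals in print for the 3D Ising critical point
(FAMILIES-v1 family `NAMED`, frozen 2026-08-20, plus the quarantined late supplements; each already
refuted in floating point — listed for CERTIFIED refutation, never as candidates):
`9/16` (Zhang 2007 = Kaupužs 2001: `η = 1/8`), `1/2` (series-era set A, `η = 0`, the free value),
`19/36` (Fisher–Burford 1967 reading `η = 1/18`), `15/31` (Thompson's set B, `δ = 26/5`,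
`Δ_σ = 3/(1+δ)`; below the unitarity bound), `899/1728` (Ghosh 2026, arXiv:2607.10865: `η = 35/864`),
`3/5` (Mojumder 1991 via Guttmann–Enting 1993: `η = 1/5`). Sources: SCOPE.md §3.2/§3.9. -/
def namedSigma : List ℚ := [9/16, 1/2, 19/36, 15/31, 899/1728, 3/5]

/-- `Δ_ε = 3 − 1/ν`-projections of the same proposals: `3/2` (`ν = 2/3`: Zhang 2007, Ghosh 2026),
`7/5` (`ν = 5/8`: series-era set A, Mojumder 1991), `13/9` (`ν = 9/14`: Fisher–Burford 1967). -/
def namedEps : List ℚ := [3/2, 7/5, 13/9]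

/-- The proposals as `(Δ_σ, Δ_ε)` pairs (FAMILIES-v1 `NAMEDJ` + late supplements NAMED-late-1 and NAMED-late-2):
Zhang–Kaupužs `(9/16, 3/2)`, series-era A `(1/2, 7/5)`, Fisher–Burford `(19/36, 13/9)`,
Ghosh 2026 `(899/1728, 3/2)`, Mojumder 1991 `(3/5, 7/5)`. -/
def namedPairs : List (ℚ × ℚ) := [(9/16, 3/2), (1/2, 7/5), (19/36, 13/9), (899/1728, 3/2), (3/5, 7/5)]

/-! ### Bridges from the floor's statements to exclusion sentences -/

/-- Under `IsingEnclosure W R`, a value that is the first coordinate of no point of `R` is not the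
`Δ_σ` of any admissible datum in the window. -/
theorem sigma_ne_of_isingEnclosure {W R : Set (ℝ × ℝ)} (h : IsingEnclosure W R) {x : ℝ}
    (hx : ∀ q ∈ R, q.1 ≠ x) (D : SigmaEpsilonData) (hD : D.SatisfiesBootstrapAxioms)
    (hW : (D.Δσ, D.Δε) ∈ W) : D.Δσ ≠ x :=
  hx _ (h D hD hW)

/-- The same for `Δ_ε`. -/
theorem eps_ne_of_isingEnclosure {W R : Set (ℝ × ℝ)} (h : IsingEnclosure W R) {y : ℝ}
    (hy : ∀ q ∈ R, q.2 ≠ y) (D : SigmaEpsilonData) (hD : D.SatisfiesBootstrapAxioms)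
    (hW : (D.Δσ, D.Δε) ∈ W) : D.Δε ≠ y :=
  hy _ (h D hD hW)

/-- Under `IsingEnclosure W R`, a point of `W` outside `R` is not attained: the certified refutation
of one in-window NAMED pair. -/
theorem point_not_attained_of_isingEnclosure {W R : Set (ℝ × ℝ)} (h : IsingEnclosure W R)
    {v : ℝ × ℝ} (hvW : v ∈ W) (hvR : v ∉ R) (D : SigmaEpsilonData)
    (hD : D.SatisfiesBootstrapAxioms) : (D.Δσ, D.Δε) ≠ v := by
  intro e
  exact hvR (e ▸ h D hD (e ▸ hvW))

/-- A point of an excluded box is not attained (one-box targets outside the window). -/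
theorem point_not_attained_of_boxExcluded {Q : Set (ℝ × ℝ)} (h : BoxExcluded Q) {v : ℝ × ℝ}
    (hv : v ∈ Q) (D : SigmaEpsilonData) (hD : D.SatisfiesBootstrapAxioms) : (D.Δσ, D.Δε) ≠ v :=
  fun e => h D hD (e ▸ hv)

/-- **RAT sentence for `Δ_σ`.** If `IsingEnclosure W R`, the `Δ_σ`-projection of `R` lies in the
rational interval `[a, b]`, and `ratExcluded Q a b ex = true`, then no admissible datum in the window
has `Δ_σ` equal to a rational of denominator `≤ Q` outside `ex`. -/
theorem sigma_ne_rat_of_isingEnclosure {W R : Set (ℝ × ℝ)} (h : IsingEnclosure W R) {a b : ℚ}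
    (hR : ∀ q ∈ R, (a : ℝ) ≤ q.1 ∧ q.1 ≤ b) {Q : ℕ} {ex : List ℚ}
    (hx : ratExcluded Q a b ex = true) (D : SigmaEpsilonData) (hD : D.SatisfiesBootstrapAxioms)
    (hW : (D.Δσ, D.Δε) ∈ W) (r : ℚ) (hden : r.den ≤ Q) (hr : r ∉ ex) : D.Δσ ≠ (r : ℝ) :=
  ne_rat_of_ratExcluded hx (hR _ (h D hD hW)) r hden hr

/-- **RAT sentence for `Δ_ε`.** -/
theorem eps_ne_rat_of_isingEnclosure {W R : Set (ℝ × ℝ)} (h : IsingEnclosure W R) {a b : ℚ}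
    (hR : ∀ q ∈ R, (a : ℝ) ≤ q.2 ∧ q.2 ≤ b) {Q : ℕ} {ex : List ℚ}
    (hx : ratExcluded Q a b ex = true) (D : SigmaEpsilonData) (hD : D.SatisfiesBootstrapAxioms)
    (hW : (D.Δσ, D.Δε) ∈ W) (r : ℚ) (hden : r.den ≤ Q) (hr : r ∉ ex) : D.Δε ≠ (r : ℝ) :=
  ne_rat_of_ratExcluded hx (hR _ (h D hD hW)) r hden hr

/-- **KAC sentence for `Δ_σ`.** If `IsingEnclosure W R`, the `Δ_σ`-projection of `R` lies in `[a, b]`,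
and `kacExcluded N nmax a b ex = true`, then no admissible datum in the window has `Δ_σ` equal to a
member of `KAC(N, nmax)` outside `ex`. -/
theorem sigma_not_kac_of_isingEnclosure {W R : Set (ℝ × ℝ)} (h : IsingEnclosure W R) {a b : ℚ}
    (hR : ∀ q ∈ R, (a : ℝ) ≤ q.1 ∧ q.1 ≤ b) {N nmax : ℕ} {ex : List ℚ}
    (hx : kacExcluded N nmax a b ex = true) (D : SigmaEpsilonData)
    (hD : D.SatisfiesBootstrapAxioms) (hW : (D.Δσ, D.Δε) ∈ W) (v : ℚ) (hv : v ∈ kacFamily N nmax)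
    (hvex : v ∉ ex) : D.Δσ ≠ (v : ℝ) :=
  ne_kac_of_kacExcluded hx (hR _ (h D hD hW)) v hv hvex

/-- **KAC sentence for `Δ_ε`.** -/
theorem eps_not_kac_of_isingEnclosure {W R : Set (ℝ × ℝ)} (h : IsingEnclosure W R) {a b : ℚ}
    (hR : ∀ q ∈ R, (a : ℝ) ≤ q.2 ∧ q.2 ≤ b) {N nmax : ℕ} {ex : List ℚ}
    (hx : kacExcluded N nmax a b ex = true) (D : SigmaEpsilonData)
    (hD : D.SatisfiesBootstrapAxioms) (hW : (D.Δσ, D.Δε) ∈ W) (v : ℚ) (hv : v ∈ kacFamily N nmax)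
    (hvex : v ∉ ex) : D.Δε ≠ (v : ℝ) :=
  ne_kac_of_kacExcluded hx (hR _ (h D hD hW)) v hv hvex

/-! ### The one catalogue entry refuted by the typed unitarity axiom alone -/

/-- A1 (`SatisfiesUnitarity`) contains `1/2 ≤ Δ_σ`; hence no admissible datum has `Δ_σ < 1/2`. -/
theorem deltaSigma_ne_of_lt_half (D : SigmaEpsilonData) (hD : D.SatisfiesBootstrapAxioms) {x : ℝ}
    (hx : x < 1 / 2) : D.Δσ ≠ x := by
  have h := hD.2.1.1
  intro e
  rw [e] at h
  exact absurd hx (not_lt.mpr h)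

/-- **Thompson's set B is refuted by A1 alone.** `Δ_σ = 15/31` (from `δ = 26/5`, Gaunt–Fisher–Sykes–
Essam 1964, via `Δ_σ = d/(1+δ)`) lies below the unitarity bound `1/2`, so no `σ–ε` datum satisfying
the bootstrap axioms attains it — independently of every certificate (SCOPE §6 v2.5 catalogue,
"BELOW A1"). -/
theorem deltaSigma_ne_fifteen_div_thirtyOne (D : SigmaEpsilonData)
    (hD : D.SatisfiesBootstrapAxioms) : D.Δσ ≠ 15 / 31 :=
  deltaSigma_ne_of_lt_half D hD (by norm_num)

end Summit.CriticalPhenomena.Ising3D
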